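import Literature.NumberTheory.PAdicHodge.AinfWeierstrassTateModuleIntegers
import Literature.NumberTheory.PAdicHodge.AinfWeierstrassTateModuleSupersingular
import HarnessLib

/-!
# The matching `T_p E(ℂ_F) ≅ T_pŴ(𝒪_{ℂ_F})` for the `𝒪_F`-model is UNCONDITIONAL at good supersingular reduction

Topic `Literature/NumberTheory/PAdicHodge`; sequel of `AinfWeierstrassTateModuleIntegers` (the object `TatePtO F W p` for a Weierstrass equation `W`
over `LTCoeff F = 𝒪_F`) and `AinfWeierstrassTateModuleSupersingular` (the case `W/ℤ`). For `W` over `𝒪_F` with GOOD reduction (`Δ_W ∈ 𝒪_F^×`)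
whose reduction `W mod 𝔪_F` is SUPERSINGULAR (odd residue characteristic `p`, Hasse invariant `0`) — exactly the situation of K★'s additive cells
after passing to the ramified field over which good reduction is attained:

* `redCoeff : LTCoeff F →+* 𝓀[F]`, `residueFieldToC : 𝓀[F] →+* 𝒪_{ℂ_F}/𝔪` (`𝔪_F ↦ 0` since `‖a‖_{ℂ_F} = ‖a‖_F < 1`), the reduction of `W ⊗ 𝒪_{ℂ_F}` is
  the base change of `W mod 𝔪_F` (`ballIntModel_map_residue_O`);
* **`mem_kernel_of_pow_prime_smul_eq_zero_ssO`**: `E[p^∞](ℂ_F) ⊂ E₁(ℂ_F)`;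
* **`tateModuleCEquivTatePtOSS : T_p E(ℂ_F) ≃ₗ[ℤ_p] TatePtO F W p`** and its `Γ_F`-equivariance, with no hypothesis left besides good
  supersingular reduction.

BSD / K★ (`Cruxes/StarredOptimalManinUnitFiveSeven/Lines/kato-lever-hDR-M-matching.md`): the object/matching half of (R1) for the three
potentially supersingular cells; nothing about elliptic curves over number fields is proved here.

## References
* J. H. Silverman, *The Arithmetic of Elliptic Curves* (2009), III.§7, V.3.1, VII.2.1–2.2. [SilvermanAEC2009]
* J. Tate, *p-divisible groups* (1967), §4. [Tate1967]
-/

noncomputable section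

open scoped Classical NNReal
open Field ValuativeRel

namespace Literature.NumberTheory.PAdicHodge

open Literature.NumberTheory.GaloisRepresentations
open Literature.NumberTheory.GaloisRepresentations.IsNonarchimedeanLocalField
open Literature.NumberTheory.GaloisRepresentations.LubinTate
open Literature.NumberTheory.EllipticCurves Literature.NumberTheory.EllipticCurves.FormalGroupChart

namespace AinfTop

variable {F : Type} [Field F] [ValuativeRel F] [TopologicalSpace F] [IsNonarchimedeanLocalField F]

/-! ## §1 Residue fields: `𝓀[F] → 𝒪_{ℂ_F}/𝔪` -/

variable (F) in
/-- The reduction `𝒪_F → 𝓀[F]` on the discrete copy `LTCoeff F`. [cite: SilvermanAEC2009, VII.§1] -/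
def redCoeff : LTCoeff F →+* 𝓀[F] := (IsLocalRing.residue 𝒪[F]).comp (LTCoeff.of F).symm.toRingHom

/-- An element of `𝔪_F` has norm `< 1` in `ℂ_F`. [cite: SilvermanAEC2009, VII.§1] -/
theorem norm_algebraMap_lt_one_of_mem_maximalIdeal {a : 𝒪[F]} (ha : a ∈ 𝓂[F]) :
    ‖algebraMap F (CompletedAlgClosure F) (a : F)‖ < 1 := by
  rw [CompletedAlgClosure.norm_algebraMap, norm_lt_one_iff]
  have hv := (Valuation.integer.integers (valuation F)).isUnit_iff_valuation_eq_one (x := a)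
  have hle : valuation F (a : F) ≤ 1 := a.2
  have hne : valuation F (a : F) ≠ 1 := fun h => ((IsLocalRing.mem_maximalIdeal _).mp ha) (hv.mpr h)
  exact lt_of_le_of_ne hle hne

/-- `𝔪_F` maps into the maximal ideal of `𝒪_{ℂ_F}`. [cite: SilvermanAEC2009, VII.§1] -/
theorem algebraMap_ltCoeff_mem_maximalIdeal {a : 𝒪[F]} (ha : a ∈ 𝓂[F]) :
    algebraMap (LTCoeff F) (CBall F) (LTCoeff.of F a) ∈ IsLocalRing.maximalIdeal (CBall F) := by
  rw [IsLocalRing.mem_maximalIdeal, mem_nonunits_iff, isUnit_unitBall_iff, coe_algebraMap_ltCoeff]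
  exact ne_of_lt (norm_algebraMap_lt_one_of_mem_maximalIdeal (by simpa using ha))

variable (F) in
/-- **`𝓀[F] → 𝒪_{ℂ_F}/𝔪`**, induced by `𝒪_F → 𝒪_{ℂ_F}`. [cite: SilvermanAEC2009, VII.§1] -/
def residueFieldToC : 𝓀[F] →+* IsLocalRing.ResidueField (CBall F) :=
  Ideal.Quotient.lift (IsLocalRing.maximalIdeal 𝒪[F])
    ((IsLocalRing.residue (CBall F)).comp ((algebraMap (LTCoeff F) (CBall F)).comp (LTCoeff.of F).toRingHom))
    fun a ha => by
      rw [RingHom.comp_apply, RingHom.comp_apply, IsLocalRing.residue_eq_zero_iff]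
      exact algebraMap_ltCoeff_mem_maximalIdeal ha

/-- Compatibility of the residue maps. [cite: SilvermanAEC2009, VII.§1] -/
theorem residueFieldToC_comp_redCoeff :
    (residueFieldToC F).comp (redCoeff F) = (IsLocalRing.residue (CBall F)).comp (algebraMap (LTCoeff F) (CBall F)) := by
  ext x
  rfl

variable (W : WeierstrassCurve (LTCoeff F))

/-- **The reduction of `W ⊗ 𝒪_{ℂ_F}` is the base change of `W mod 𝔪_F`.** [cite: SilvermanAEC2009, VII.§1] -/
theorem ballIntModel_map_residue_O :
    (ballIntModel (CompletedAlgClosure F) W).map (IsLocalRing.residue (CBall F)) = (W.map (redCoeff F)).map (residueFieldToC F) := by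
  rw [ballIntModel, WeierstrassCurve.map_map, WeierstrassCurve.map_map, residueFieldToC_comp_redCoeff]

/-- Good reduction of the `𝒪_F`-model gives unit discriminant over `𝒪_{ℂ_F}`. [cite: SilvermanAEC2009, VII.§1] -/
theorem isUnit_Δ_ballIntModel_O (hΔ : IsUnit W.Δ) : IsUnit (ballIntModel (CompletedAlgClosure F) W).Δ := by
  rw [ballIntModel, WeierstrassCurve.map_Δ]; exact hΔ.map _

variable {p : ℕ} [Fact p.Prime]

/-- **No `p`-torsion in the reduction of `W ⊗ 𝒪_{ℂ_F}`** when `W mod 𝔪_F` is supersingular (`p` odd = residue characteristic, `A_p = 0`).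
[cite: SilvermanAEC2009, Thm. V.3.1(a)] -/
theorem reduction_no_pTorsion_O [CharP 𝓀[F] p] (hp2 : p ≠ 2) (hΔ : IsUnit W.Δ) (hA : (W.map (redCoeff F)).hasseCoeff p = 0)
    (Q : ((ballIntModel (CompletedAlgClosure F) W).map (IsLocalRing.residue (CBall F))).toAffine.Point) (hQ : (p : ℤ) • Q = 0) : Q = 0 := by
  letI : Fintype 𝓀[F] := Fintype.ofFinite _
  haveI : (W.map (redCoeff F)).IsElliptic := ⟨by rw [WeierstrassCurve.map_Δ]; exact hΔ.map _⟩
  set e := WeierstrassCurve.Affine.Point.congrEquiv (ballIntModel_map_residue_O W)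
  have h1 : (p : ℤ) • e Q = 0 := by rw [← map_zsmul, hQ, map_zero]
  have h2 := eq_zero_of_prime_zsmul_eq_zero_map_of_hasseCoeff_eq_zero (W.map (redCoeff F)) hp2 hA (residueFieldToC F) (e Q) h1
  exact e.injective (h2.trans (map_zero e).symm)

variable {W}

/-- **`E[pⁿ](ℂ_F) ⊂ E₁(ℂ_F)` for the `𝒪_F`-model with good supersingular reduction.** [cite: SilvermanAEC2009, Prop. VII.2.1] -/
theorem mem_kernel_of_pow_prime_smul_eq_zero_ssO [CharP 𝓀[F] p] (hp2 : p ≠ 2) (hΔ : IsUnit W.Δ)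
    (hA : (W.map (redCoeff F)).hasseCoeff p = 0) (n : ℕ) (P : (curveOver (CompletedAlgClosure F) W).toAffine.Point)
    (hP : p ^ n • P = 0) : P ∈ kernel (NormedField.valuation (K := CompletedAlgClosure F)) (curveOver (CompletedAlgClosure F) W) :=
  mem_kernel_of_pow_prime_smul_eq_zero (isUnit_Δ_ballIntModel_O W hΔ) (reduction_no_pTorsion_O W hp2 hΔ hA) n P hP

/-- `W ⊗ ℂ_F` is elliptic for the good model. [cite: SilvermanAEC2009, III.§1] -/
theorem isElliptic_curveOverC_O (hΔ : IsUnit W.Δ) : (curveOver (CompletedAlgClosure F) W).IsElliptic :=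
  ⟨by
    rw [curveOver, WeierstrassCurve.baseChange, WeierstrassCurve.map_Δ]
    exact (isUnit_Δ_ballIntModel_O W hΔ).map _⟩

variable (F W p) in
/-- **`T_p E(ℂ_F) ≃ₗ[ℤ_p] T_pŴ(𝒪_{ℂ_F})` for the `𝒪_F`-model, UNCONDITIONALLY at good supersingular reduction** (`p` odd = residue characteristic).
[cite: SilvermanAEC2009, Prop. VII.2.2] [cite: Tate1967, §4] -/
def tateModuleCEquivTatePtOSS [CharP 𝓀[F] p] (hp2 : p ≠ 2) (hΔ : IsUnit W.Δ) (hA : (W.map (redCoeff F)).hasseCoeff p = 0) :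
    TateModule (curveOver (CompletedAlgClosure F) W).toAffine.Point p ≃ₗ[ℤ_[p]] TatePtO F W p :=
  haveI := isElliptic_curveOverC_O (F := F) hΔ
  tateModuleCEquivTatePtO F W p (mem_kernel_of_pow_prime_smul_eq_zero_ssO hp2 hΔ hA)

/-- **Γ_F-equivariance** of `tateModuleCEquivTatePtOSS` (coordinatewise `σ` on `E(ℂ_F)` ↔ `tatePtORep σ`). [cite: Tate1967, §4] -/
theorem tateModuleCEquivTatePtOSS_galois [CharP 𝓀[F] p] (hp2 : p ≠ 2) (hΔ : IsUnit W.Δ) (hA : (W.map (redCoeff F)).hasseCoeff p = 0)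
    (σ : absoluteGaloisGroup F) (τ : TateModule (curveOver (CompletedAlgClosure F) W).toAffine.Point p) :
    tateModuleCEquivTatePtOSS F W p hp2 hΔ hA (TateModule.map p (galPointCO W σ) τ) =
      tatePtORep F W p σ (tateModuleCEquivTatePtOSS F W p hp2 hΔ hA τ) := by
  haveI := isElliptic_curveOverC_O (F := F) hΔ
  rw [tatePtORep_apply_apply]
  exact tateModuleCEquivTatePtO_galois W _ σ τ

end AinfTop

end Literature.NumberTheory.PAdicHodge

end
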